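import Summits.QuantumFields.BalabanUV.Beta.GAN24.CombLin4Transport
import Summits.QuantumFields.BalabanUV.Beta.GAN24.CombForcingPairForm
import Summits.QuantumFields.BalabanUV.Beta.SymCorrectorLiteralLoc
import Summits.QuantumFields.BalabanUV.Beta.SymCorrectorW2Gauge

/-!
# `BalabanUV.Beta.GAN24.CombForcingTransport` — binder row G-an2-4 ∕ (CONV-C), TRANSFER-III, the (III′) (C)-campaign's ONE remaining supplier `hB0` (memo M-1 §2 row
# «`hB0` … the campaign's CORE RISK», the OWNER gan24-p1 g51's plug (J) `CombChartChargeTowerPairFormClosed` displays it raw): **(Q1) FOR THE FORCING — THE COMB-CHART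
# FORCING IS THE bm-CHART FORCING FUNCTIONAL ON 𝒯-TRANSPORTED TABLES, WITH THE CARRIER PUSHED THROUGH:**
# `mmRead Lc (K3OfK X̃′ Lc S̃′ M̃′ (W2SymOfK X̃′ Lc S̃′ M̃′ 0 M̃₂′)) = mmRead Lc (K3OfK X̃ Lc (𝒯S̃′) (𝒯′M̃′) (W2SymOfK X̃ Lc (𝒯S̃′) (𝒯′M̃′) 0 (𝒯₂M̃₂′)))`,
# `X̃′ = unitK s_f s_m (GcombSh Lc i)`, `X̃ = unitK s_f s_m (coDressKBmAt ρ_c Lc (KInvStep Lc i))` — so leaf-04's GENERIC two-face read-out 21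
# `DressedSourceZeroModeWords.zmode_dressedSource_inl_inl` (ANY localised `S M W`, any border without ff block) applies to `hB0`'s summand at the comb data VERBATIM
# (G-an2-4 CRUX TEAM (2), leaf prover `b2b-balaban-gan24-formalise-leaf-01`, gen 85; journal [LEAF01-G85-INTENT-1])

NOT IN PRINT; OUR BOOKKEEPING ([folklore] tame-kernel bookkeeping BY NAME over road-P2 g55's M.43 `CombCubicStepTransport.conj_vertexOfK_eq_vertexOfK_conj` ∕ M.45
`CombQuarticStepTransport.{conj_vertexOfM_eq_vertexOfM_conj, conj_dM_eq_dM_conj, e4OfKW_conj_psiKS}`, d1-formalise-leaf-03's `SymCorrectorLiteralW.W2SymOfK_conj_psiKS` ((W-pair) ∕ (iv) ∕ (D-R)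
words of a `Ψ̂`-conjugate) and `SymCorrectorLiteralLoc.{locStencilFM_slotPsiS, loc_transportedW, legDress_half_add, loc_vertex2OfK_slot₂, loc_mixOfK_slot, loc_resp_slot, loc_inner ∘ loc_dM_of_spr}`,
leaf-03 g79's `CombLin4Transport.unitK_conj_psiKS`, an2's `CombChartTransportLevel.GcombSh_eq_conj_psiKS_KInvStep` (`G′_j = Ψ̂_S ∘ G_j ∘ Ψ̂_Sᵀ`, every `j`), leaf-02 g78's
`CombForcingPairForm` §1 root letters; 0 `def`, 0 cited fact, 0 `def … : Prop`, 0 sorry).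
HONEST FRAMING (cell contract, verbatim): «discharging `BetaPertH` makes Bałaban's UV stability UNCONDITIONAL — a real constructive-QFT result; it is NOT the continuum limit and NOT
the Clay problem.»  HONEST DEPENDENCY (verbatim): «continuum YM on T⁴ ⇐ BetaPertH ∧ nine spine estimates (0/9 proved); BetaPertH ⇐ (D1) ∧ (D4) ∧ CAP+tail; G-an2-4 gates asym, D1
and NE2/3/4.»
## Why (context only; asserted nowhere below)
After the OWNER's (C)–(J) the (III′) closure costs exactly `hB0` (the LS-symmetrised ff cell charge of `b̃′_i = c • mmRead Lc (K3OfK X̃′_i Lc S̃′_i M̃′_i (W2SymOfK X̃′_i Lc S̃′_i M̃′_i 0 M̃₂′_i))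
+ cB • vh₂S` is a pair form at every `i`).  At (E) this is leaf-06 #66 over leaf-04's 33_j, whose first line 21 is GENERIC in the tables but reads the kernel `X̃♮_j = unitK s_f s_m (coDressKBmAt
ρ Lc (KInvStep Lc j))` POINTWISE.  The comb kernel is `X̃′_i = unitK (Ψ̂_S ∘ G_i ∘ Ψ̂_Sᵀ)`; d1-leaf-03 computed `W2SymOfK (Ψ̂KΨ̂ᵀ) …` word by word with UNconjugated outer legs, M.45 moved the
quartic step onto transported tables with the carrier `𝒯′W` left as a letter.  Here the outer legs of the four (W-pair)∕(iv)∕(D-R) words are conjugated into their tables (§1), so the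
leg-transported carrier of the conjugated kernel IS the carrier of `K` on transported tables, the whole forcing word is the bm functional on `(𝒯S, 𝒯′M, 𝒯₄S₂, 𝒯₂M₂)` (§2), and with units
at the comb data (§3) `hB0`'s summand is literally leaf-04's 21-shape source at the centre root (§4).  NEGATIVE READING (leaf-01 g85, L-leaf01-g85-1): the transports interleaved BELOW
level `i` do NOT drop out of the cell charges from `i = 1` on (the level-`i` slot-summed zero fibre of `S̃′_i` is a PARTIAL `Lc²`-fold at level `i−1`, where `Ψ̂_S(q) ≠ 1`) — this file is
the first line of the (E) PATTERN on transported tables, not of a transport-free reduction.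

## What is proved (generic `d`; `0 < n`, `r ∈ box (d+1) n`, `Ψ̂ := psiKS r n`; transports `𝒯S κ u := Ψ̂ᵀ∘slotPsiS r n S κ u∘Ψ̂`, `𝒯′M ρ w := Ψ̂ᵀ∘M ρ w∘Ψ̂`,
## `𝒯₄S₂ α x β x′ := Ψ̂ᵀ∘slotPsiS r n (slotPsiS r n S₂ α x) β x′∘Ψ̂` (leaf-01 g84's four-slot table, left-first bracketing), `𝒯₂M₂ κ u ρ w := Ψ̂ᵀ∘(slotPsiS r n M₂) κ u ρ w∘Ψ̂`)
* §1 leg congruences into the tables (spread `P`, spread `K`; d1-leaf-03's `SymCorrectorW2Gauge.decays_of_loc` socket): `locStencil_vertexOfM_slice`; **`conj_vertex2OfK_eq_vertex2OfK_conj`** (`LocStencil₂ T`), **`conj_mixOfK_eq_mixOfK_conj`**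
  (`LocStencilFM n M₂`); **`conj_W2SymOfK_conj_psiKS`**: `Ψ̂ᵀ ∘ W2SymOfK (Ψ̂∘K∘Ψ̂ᵀ) n S M S₂ M₂ μ y ν y′ ∘ Ψ̂ = W2SymOfK K n (𝒯S) (𝒯′M) (𝒯₄S₂) (𝒯₂M₂) μ y ν y′` (and the `W2OfK` member form
  `conj_transportedW_eq`).
* §2 **`mmRead_K3OfK_W2SymOfK_conj_psiKS`**: `mmRead n (K3OfK (Ψ̂KΨ̂ᵀ) n S M (W2SymOfK (Ψ̂KΨ̂ᵀ) n S M S₂ M₂) μ y ν y′) = mmRead n (K3OfK K n (𝒯S) (𝒯′M) (W2SymOfK K n (𝒯S) (𝒯′M) (𝒯₄S₂) (𝒯₂M₂)) μ y ν y′)`.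
* §3 THE (III′) INSTANCE (`[NeZero Lc]`, ANY `tabs : SymTables d Lc`, ANY units `s_f s_m`, pins `cE cVH cΛ`, every level `i`, `Ψ̂_S = psiKS (ctrOff (d+1) Lc) Lc`, `ρ_c = ctr (d+1) Lc`):
  `fourSlot_zero` (`𝒯₄ 0 = 0`); **`combForcing_eq_bm_transport`** — the displayed identity above, every bond pair; `combForcingTable_eq_bm_transport` (as bi-stencil tables, any `c cB B`).
* §4 **`zmode_combForcing_eq_bm_transport`** — `hB0`'s summand: `zmode N (c • [comb forcing] + cB • B) = zmode N (c • [bm functional on transported tables] + cB • B)`, every `N`, every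
  direction ∕ leg pair; `zmode_combForcing_eq_bm_transport_lit` — `d = 3`, units `sfStep ∕ smStep`, `symTablesAn1S2 3 Lc cΛt`, `c = cE₂·Lc^{2(3+1)}`, `B = tabs.vh₂S` (the OWNER's (J) tokens).
WHAT THIS IS NOT: NOT `hB0` at any level; NO value of any table or charge; NOT (d′)∕(d″) (Engine C E0 ✓ at l = 0, E1 running); the transported tables' sector split ∕ current symmetry ∕ EE words
(33_j's internals at the comb data) are NOT touched; the (III′) campaign is NOT asked (an2 W-4 l.64553); NEVER «G-an2-4 closed» as (CONV-C); NOT D1, NOT `BetaPertH`, NOT continuum, NOT Clay.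
2026-08-27; no existing file touched.
-/

noncomputable section

open Finset
open scoped BigOperators
open Literature.MathematicalPhysics.QuantumFieldTheory
open Literature.MathematicalPhysics.QuantumFieldTheory.Balaban1983to89
open Literature.MathematicalPhysics.QuantumFieldTheory.Balaban1983to89.Beta
open B12Sec2to5 (l1 l1_nonneg)
open ExpKernelCalculus (Site MKer Decays BiLoc VertexFamily VertexFamily₂ comp Zl Zl_nonneg)
open OneStepResolventKernel (Fib LocStencil biLoc_mono)
open OneStepKernelFamily (KInvStep vertexOfK)
open AffineAveraging (box toSite)
open AveragingContoursRooted (ctr ctrOff ctrOff_mem_box)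
open BalabanCompositeJets (LocStencil₂)
open SecondOrderResponse (vertexOfM dM K2OfK vertex2OfK mixOfK W2OfK W2SymOfK W2OfK_apply LocStencilFM biLoc_vertexOfM_slice vertexFamily₂_W2SymOfK')
open BalabanStepJetsSucc (mmRead)
open BalabanStepW2 (K3OfK M2Of)
open Summit.QuantumFields.BalabanUV.Beta.TameKernelCalculus
open Summit.QuantumFields.BalabanUV.Beta.ChartConjugationRelative (spr_comp)
open Summit.QuantumFields.BalabanUV.Beta.AxialDressingRooted (coDressKBmAt decays_coDressKBmAt_KInvStep)
open Summit.QuantumFields.BalabanUV.Beta.HessKerDressedUnits (unitK unitS decays_unitK)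
open Summit.QuantumFields.BalabanUV.Beta.SecondOrderUnits (unitM unitM₂)
open Summit.QuantumFields.BalabanUV.Beta.SymmetrisedStepJets (SymTables)
open Summit.QuantumFields.BalabanUV.Beta.SymSecondOrderTablesAn1 (symTablesAn1S2)
open Summit.QuantumFields.BalabanUV.Beta.CombChartStepJets (GcombSh SpureCombOf)
open Summit.QuantumFields.BalabanUV.Beta.CombChartTransportLevel (GcombSh_eq_conj_psiKS_KInvStep)
open Summit.QuantumFields.BalabanUV.Beta.SymCorrectorKernel (psiKS spr_psiKS)
open Summit.QuantumFields.BalabanUV.Beta.SymCorrectorFace (slotPsiS slotPsiS_zero)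
open Summit.QuantumFields.BalabanUV.Beta.SymCorrectorSockets (locStencil_slotPsiS locStencil₂_slotPsiS₂)
open Summit.QuantumFields.BalabanUV.Beta.SymCorrectorRest (abs_mixed_slice_le loc_inner)
open Summit.QuantumFields.BalabanUV.Beta.SymCorrectorLiteralW (loc_dM_of_spr W2SymOfK_conj_psiKS)
open Summit.QuantumFields.BalabanUV.Beta.SymCorrectorW2Gauge (decays_of_loc)
open Summit.QuantumFields.BalabanUV.Beta.SymCorrectorLiteralLoc (locStencilFM_slotPsiS loc_of_vertexFamily₂ loc_vertex2OfK_slot₂ loc_mixOfK_slot loc_resp_slot legDress_half_add)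
open Summit.QuantumFields.BalabanUV.Beta.GAN24.CombCubicStepTransport (conj_vertexOfK_eq_vertexOfK_conj locStencil_transportPsiS)
open Summit.QuantumFields.BalabanUV.Beta.GAN24.CombQuarticStepTransport (conj_vertexOfM_eq_vertexOfM_conj conj_dM_eq_dM_conj e4OfKW_conj_psiKS)
open Summit.QuantumFields.BalabanUV.Beta.GAN24.CombLin4Transport (unitK_conj_psiKS)
open Summit.QuantumFields.BalabanUV.Beta.GAN24.LinT2CoDressed (locStencil_slice locStencil_vertexOfK_slice)
open Summit.QuantumFields.BalabanUV.Beta.GAN24.CombForcingPairForm (exists_locStencil_unitS_SpureCombOf exists_vertexFamily_unitM_tabs exists_locStencilFM_unitM₂_M2Of_tabs)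
open Summit.QuantumFields.BalabanUV.Beta.GAN24.BiStencilZeroMode (Tab zmode)
open Summit.QuantumFields.BalabanUV.Beta.GAN24.CombesThomas (sfStep smStep)

namespace Summit.QuantumFields.BalabanUV.Beta.GAN24.CombForcingTransport

variable {d : ℕ}

/-! ## §1 Leg congruences move into the tables; the symmetrised carrier of a conjugated kernel, fully transported -/

section Congruence

variable {n : ℕ}

/-- [folklore] **THE INNER MULTIPLIER VERTEX OF A MIXED SLICE IS A LOCAL STENCIL FAMILY** (an1's `biLoc_vertexOfM_slice` with the far-centre factor dropped):
`κ u ↦ vertexOfM K n (M₂ κ u) ν y′` is `LocStencil ((d+1)·C·C₂·Zl(m∕2)) m`. -/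
theorem locStencil_vertexOfM_slice [NeZero n] {K : MKer (d + 1) (Fib d)} {C m : ℝ} (hK : Decays K C m) (hm : 0 < m)
    {M₂ : Fin (d + 1) → Site (d + 1) → Fin (d + 1) → Site (d + 1) → MKer (d + 1) (Fib d)} {C₂ : ℝ} (hM₂ : LocStencilFM n M₂ C₂ m)
    (ν : Fin (d + 1)) (y' : Site (d + 1)) :
    LocStencil (fun κ u => vertexOfM K n (M₂ κ u) ν y') ((d + 1 : ℕ) * (C * C₂ * Zl (d + 1) (m / 2))) m := by
  have hC : 0 ≤ C := hK.nonneg (Sum.inl 0); have hC₂ : 0 ≤ C₂ := hM₂.nonneg; have hZ : 0 ≤ Zl (d + 1) (m / 2) := Zl_nonneg (half_pos hm)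
  intro κ u x z a b
  refine (biLoc_vertexOfM_slice (N := n) hK hC hM₂ hm κ u ν y' x z a b).trans (mul_le_mul_of_nonneg_right ?_ (Real.exp_pos _).le)
  have he : Real.exp (-(m / 2) * l1 (u - (n : ℤ) • y')) ≤ 1 := Real.exp_le_one_iff.2 (by nlinarith [l1_nonneg (u - (n : ℤ) • y')])
  calc ((d + 1 : ℕ) : ℝ) * (C * C₂ * Zl (d + 1) (m / 2) * Real.exp (-(m / 2) * l1 (u - (n : ℤ) • y')))
      ≤ ((d + 1 : ℕ) : ℝ) * (C * C₂ * Zl (d + 1) (m / 2) * 1) := by gcongr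
    _ = _ := by ring

/-- NOT IN PRINT; OUR BOOKKEEPING ([folklore]; leaf-03 g79's `conj2` inside `CombLin4Transport.conj_vsym_eq_vsym_conj`, as a lemma).  **THE LEG CONGRUENCE OF THE BI-VERTEX PASSES TO THE
TABLE**: spread `P`, `K`, `LocStencil₂ T` (`0 < δ`): `Pᵀ ∘ vertex2OfK K n T b b′ ∘ P = vertex2OfK K n (κ u κ′ u′ ↦ Pᵀ ∘ T κ u κ′ u′ ∘ P) b b′` (M.43 §2 twice). -/
theorem conj_vertex2OfK_eq_vertex2OfK_conj {P K : MKer (d + 1) (Fib d)} (hP : Spr P) (hK : Spr K)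
    {T : Fin (d + 1) → Site (d + 1) → Fin (d + 1) → Site (d + 1) → MKer (d + 1) (Fib d)} {CT δT : ℝ} (hT : LocStencil₂ T CT δT) (hδT : 0 < δT)
    (μ : Fin (d + 1)) (y : Site (d + 1)) (ν : Fin (d + 1)) (y' : Site (d + 1)) :
    comp (comp (trK P) (vertex2OfK K n T μ y ν y')) P = vertex2OfK K n (fun κ u κ' u' => comp (comp (trK P) (T κ u κ' u')) P) μ y ν y' := by
  obtain ⟨CK, δK, hδK, hKd⟩ := id hK
  have hK2 : ∃ δ C : ℝ, 0 < δ ∧ 0 ≤ C ∧ Decays K C δ := ⟨δK, |CK|, hδK, abs_nonneg CK, decays_of_le hKd le_rfl⟩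
  have hm0 : 0 < min δK δT := lt_min hδK hδT
  have hTm : LocStencil₂ T CT (min δK δT) := hT.mono (min_le_right _ _)
  unfold SecondOrderResponse.vertex2OfK
  rw [conj_vertexOfK_eq_vertexOfK_conj (N := n) hP hK2 (locStencil_vertexOfK_slice (N := n) (decays_of_le hKd (min_le_left _ _)) hm0 hTm ν y') hm0 μ y]
  congr 1; funext κ u
  exact conj_vertexOfK_eq_vertexOfK_conj (N := n) hP hK2 (locStencil_slice hTm hm0.le κ u) (half_pos hm0) ν y'

/-- NOT IN PRINT; OUR BOOKKEEPING ([folklore]).  **THE LEG CONGRUENCE OF THE MIXED BI-VERTEX PASSES TO THE TABLE**: for spread `P`, `K` and a `LocStencilFM` field–multiplier table `M₂`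
(`0 < δ`), `Pᵀ ∘ mixOfK K n M₂ b b′ ∘ P = mixOfK K n (κ u ρ w ↦ Pᵀ ∘ M₂ κ u ρ w ∘ P) b b′` (outer slot M.43 §2 on the inner-vertex family `locStencil_vertexOfM_slice`, inner slot M.45 §2 per
field bond on the bounded multiplier family `M₂ κ u`). -/
theorem conj_mixOfK_eq_mixOfK_conj (hn : 0 < n) {P K : MKer (d + 1) (Fib d)} (hP : Spr P) (hK : Spr K)
    {M₂ : Fin (d + 1) → Site (d + 1) → Fin (d + 1) → Site (d + 1) → MKer (d + 1) (Fib d)} {C₂ δ₂ : ℝ} (hM₂ : LocStencilFM n M₂ C₂ δ₂) (hδ₂ : 0 < δ₂)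
    (μ : Fin (d + 1)) (y : Site (d + 1)) (ν : Fin (d + 1)) (y' : Site (d + 1)) :
    comp (comp (trK P) (mixOfK K n M₂ μ y ν y')) P = mixOfK K n (fun κ u ρ w => comp (comp (trK P) (M₂ κ u ρ w)) P) μ y ν y' := by
  haveI : NeZero n := ⟨hn.ne'⟩
  obtain ⟨CK, δK, hδK, hKd⟩ := id hK
  have hK2 : ∃ δ C : ℝ, 0 < δ ∧ 0 ≤ C ∧ Decays K C δ := ⟨δK, |CK|, hδK, abs_nonneg CK, decays_of_le hKd le_rfl⟩
  have hm0 : 0 < min δK δ₂ := lt_min hδK hδ₂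
  unfold SecondOrderResponse.mixOfK
  rw [conj_vertexOfK_eq_vertexOfK_conj (N := n) hP hK2
    (locStencil_vertexOfM_slice (decays_of_le hKd (min_le_left _ _)) hm0 (hM₂.mono (min_le_right _ _)) ν y') hm0 μ y]
  congr 1; funext κ u
  exact conj_vertexOfM_eq_vertexOfM_conj (N := n) hP hK2 (fun ρ w x z a b => abs_mixed_slice_le hM₂ hδ₂.le κ u ρ w x z a b) ν y'

variable (hn : 0 < n) {r : Fin (d + 1) → ℕ} (hr : r ∈ box (d + 1) n)
include hn hr

/-- NOT IN PRINT; OUR BOOKKEEPING ([folklore]).  **THE TRANSPORTED (W-pair)∕(iv)∕(D-R) WORDS, LEG-CONJUGATED, ARE THE `W2OfK` MEMBER OF `K` ON TRANSPORTED TABLES**: with `E b b′` the right-hand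
side of d1-leaf-03's `W2OfK_conj_psiKS'` (bi-vertex on `slot∘slot S₂`, two mixed bi-vertices on `slot M₂`, the `dM ∘ K2` word through the conjugated sandwich on `slot S`),
`Ψ̂ᵀ ∘ E μ y ν y′ ∘ Ψ̂ = W2OfK K n (𝒯S) (𝒯′M) (𝒯₄S₂) (𝒯₂M₂) μ y ν y′`. -/
theorem conj_transportedW_eq {K : MKer (d + 1) (Fib d)} (hK : Spr K)
    {S : Fin (d + 1) → Site (d + 1) → MKer (d + 1) (Fib d)} {Cs δs : ℝ} (hS : LocStencil S Cs δs) (hδs : 0 < δs)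
    {M : Fin (d + 1) → Site (d + 1) → MKer (d + 1) (Fib d)} {CM δM : ℝ} (hM : VertexFamily M n CM δM) (hδM : 0 < δM)
    {S₂ : Fin (d + 1) → Site (d + 1) → Fin (d + 1) → Site (d + 1) → MKer (d + 1) (Fib d)} {C₂ δ₂ : ℝ} (hS₂ : LocStencil₂ S₂ C₂ δ₂) (hδ₂ : 0 < δ₂)
    {M₂ : Fin (d + 1) → Site (d + 1) → Fin (d + 1) → Site (d + 1) → MKer (d + 1) (Fib d)} {CF δF : ℝ} (hM₂ : LocStencilFM n M₂ CF δF) (hδF : 0 < δF)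
    (μ : Fin (d + 1)) (y : Site (d + 1)) (ν : Fin (d + 1)) (y' : Site (d + 1)) :
    comp (comp (trK (psiKS r n))
        (vertex2OfK K n (fun α x => slotPsiS r n (slotPsiS r n S₂ α x)) μ y ν y'
          + mixOfK K n (slotPsiS r n M₂) μ y ν y' + mixOfK K n (slotPsiS r n M₂) ν y' μ y
          + dM (-(comp (comp K (comp (comp (trK (psiKS r n)) (dM K n (slotPsiS r n S) M ν y')) (psiKS r n))) K)) n (slotPsiS r n S) M μ y))
      (psiKS r n)
      = W2OfK K n (fun κ u => comp (comp (trK (psiKS r n)) (slotPsiS r n S κ u)) (psiKS r n))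
          (fun ρ w => comp (comp (trK (psiKS r n)) (M ρ w)) (psiKS r n))
          (fun α x β x' => comp (comp (trK (psiKS r n)) (slotPsiS r n (slotPsiS r n S₂ α x) β x')) (psiKS r n))
          (fun κ u ρ w => comp (comp (trK (psiKS r n)) (slotPsiS r n M₂ κ u ρ w)) (psiKS r n)) μ y ν y' := by
  haveI : NeZero n := ⟨hn.ne'⟩
  set P : MKer (d + 1) (Fib d) := psiKS r n with hP
  have hΨ : Spr P := spr_psiKS hn hr
  have hΨt : Spr (trK P) := hΨ.trK
  obtain ⟨CK, δK, hδK, hKd⟩ := id hK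
  have hK2 : ∃ δ C : ℝ, 0 < δ ∧ 0 ≤ C ∧ Decays K C δ := ⟨δK, |CK|, hδK, abs_nonneg CK, decays_of_le hKd le_rfl⟩
  -- the transported tables' sockets; the four words are localised (d1-leaf-03 TT9)
  have hSΨ := locStencil_slotPsiS (d := d) hn r hS hδs.le
  have hA : Loc (vertex2OfK K n (fun α x => slotPsiS r n (slotPsiS r n S₂ α x)) μ y ν y') := loc_vertex2OfK_slot₂ hn hK hS₂ hδ₂ μ y ν y'
  have hB : Loc (mixOfK K n (slotPsiS r n M₂) μ y ν y') := loc_mixOfK_slot hn hK hM₂ hδF μ y ν y'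
  have hC : Loc (mixOfK K n (slotPsiS r n M₂) ν y' μ y) := loc_mixOfK_slot hn hK hM₂ hδF ν y' μ y
  have hD := loc_resp_slot hn hr hK hS hδs hM hδM μ y ν y'
  -- distribute the leg congruence over the four localised words
  rw [comp_add_right_tame hΨt.tame ((hA.add hB).add hC).tame hD.tame, comp_add_left_tame (hΨt.comp_loc ((hA.add hB).add hC)).tame (hΨt.comp_loc hD).tame hΨ.tame,
    comp_add_right_tame hΨt.tame (hA.add hB).tame hC.tame, comp_add_left_tame (hΨt.comp_loc (hA.add hB)).tame (hΨt.comp_loc hC).tame hΨ.tame,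
    comp_add_right_tame hΨt.tame hA.tame hB.tame, comp_add_left_tame (hΨt.comp_loc hA).tame (hΨt.comp_loc hB).tame hΨ.tame]
  -- word by word
  rw [hP, conj_vertex2OfK_eq_vertex2OfK_conj (n := n) hΨ hK (locStencil₂_slotPsiS₂ (d := d) hn r hS₂ hδ₂.le) hδ₂ μ y ν y',
    conj_mixOfK_eq_mixOfK_conj hn hΨ hK (locStencilFM_slotPsiS (d := d) hn r hM₂ hδF.le) hδF μ y ν y',
    conj_mixOfK_eq_mixOfK_conj hn hΨ hK (locStencilFM_slotPsiS (d := d) hn r hM₂ hδF.le) hδF ν y' μ y]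
  -- the response word: outer slots onto `Y`, then `Y`'s inner derivative onto the transported tables
  have hY : Loc (-(comp (comp K (comp (comp (trK (psiKS r n)) (dM K n (slotPsiS r n S) M ν y')) (psiKS r n))) K)) :=
    loc_inner hn hr hK (loc_dM_of_spr hK hSΨ hδs hM hδM ν y')
  rw [conj_dM_eq_dM_conj (N := n) hΨ (decays_of_loc hY) hSΨ hδs hM hδM μ y, conj_dM_eq_dM_conj (N := n) hΨ hK2 hSΨ hδs hM hδM ν y']
  -- `−(K ∘ dM K n (𝒯S) (𝒯′M) b′ ∘ K)` IS `K2OfK K n (𝒯S) (𝒯′M) b′` and the four members are `W2OfK` (`rfl`)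
  rw [W2OfK_apply]
  rfl

/-- NOT IN PRINT; OUR BOOKKEEPING ([folklore]; (Q1) FOR THE CARRIER).  **THE SYMMETRISED CARRIER OF A `Ψ̂`-CONJUGATED KERNEL, LEG-TRANSPORTED, IS THE CARRIER OF `K` ON TRANSPORTED TABLES**:
for spread `K`, local `S` (`0 < δ`), a multiplier vertex family `M` (`0 < δ`), a `LocStencil₂` pair table `S₂` (`0 < δ`), a `LocStencilFM` mixed table `M₂` (`0 < δ`), `0 < n`, `r ∈ box (d+1) n`,
`Ψ̂ = psiKS r n`, every bond pair:
`Ψ̂ᵀ ∘ W2SymOfK (Ψ̂∘K∘Ψ̂ᵀ) n S M S₂ M₂ μ y ν y′ ∘ Ψ̂ = W2SymOfK K n (𝒯S) (𝒯′M) (𝒯₄S₂) (𝒯₂M₂) μ y ν y′`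
(d1-leaf-03's `W2SymOfK_conj_psiKS` ⨾ `legDress_half_add` ⨾ `conj_transportedW_eq` on both bond orders). -/
theorem conj_W2SymOfK_conj_psiKS {K : MKer (d + 1) (Fib d)} (hK : Spr K)
    {S : Fin (d + 1) → Site (d + 1) → MKer (d + 1) (Fib d)} {Cs δs : ℝ} (hS : LocStencil S Cs δs) (hδs : 0 < δs)
    {M : Fin (d + 1) → Site (d + 1) → MKer (d + 1) (Fib d)} {CM δM : ℝ} (hM : VertexFamily M n CM δM) (hδM : 0 < δM)
    {S₂ : Fin (d + 1) → Site (d + 1) → Fin (d + 1) → Site (d + 1) → MKer (d + 1) (Fib d)} {C₂ δ₂ : ℝ} (hS₂ : LocStencil₂ S₂ C₂ δ₂) (hδ₂ : 0 < δ₂)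
    {M₂ : Fin (d + 1) → Site (d + 1) → Fin (d + 1) → Site (d + 1) → MKer (d + 1) (Fib d)} {CF δF : ℝ} (hM₂ : LocStencilFM n M₂ CF δF) (hδF : 0 < δF)
    (μ : Fin (d + 1)) (y : Site (d + 1)) (ν : Fin (d + 1)) (y' : Site (d + 1)) :
    comp (comp (trK (psiKS r n)) (W2SymOfK (comp (comp (psiKS r n) K) (trK (psiKS r n))) n S M S₂ M₂ μ y ν y')) (psiKS r n)
      = W2SymOfK K n (fun κ u => comp (comp (trK (psiKS r n)) (slotPsiS r n S κ u)) (psiKS r n))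
          (fun ρ w => comp (comp (trK (psiKS r n)) (M ρ w)) (psiKS r n))
          (fun α x β x' => comp (comp (trK (psiKS r n)) (slotPsiS r n (slotPsiS r n S₂ α x) β x')) (psiKS r n))
          (fun κ u ρ w => comp (comp (trK (psiKS r n)) (slotPsiS r n M₂ κ u ρ w)) (psiKS r n)) μ y ν y' := by
  have hΨ : Spr (psiKS r n) := spr_psiKS hn hr
  rw [W2SymOfK_conj_psiKS hn hr hK hS hδs hM hδM hS₂ hδ₂ hM₂ hδF μ y ν y',
    legDress_half_add hΨ (SymCorrectorLiteralLoc.loc_transportedW hn hr hK hS hδs hM hδM hS₂ hδ₂ hM₂ hδF μ y ν y')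
      (SymCorrectorLiteralLoc.loc_transportedW hn hr hK hS hδs hM hδM hS₂ hδ₂ hM₂ hδF ν y' μ y),
    conj_transportedW_eq hn hr hK hS hδs hM hδM hS₂ hδ₂ hM₂ hδF μ y ν y', conj_transportedW_eq hn hr hK hS hδs hM hδM hS₂ hδ₂ hM₂ hδF ν y' μ y]
  rfl

end Congruence

/-! ## §2 The whole forcing word of a conjugated kernel -/

section Forcing

variable {n : ℕ} (hn : 0 < n) {r : Fin (d + 1) → ℕ} (hr : r ∈ box (d + 1) n)
include hn hr

/-- NOT IN PRINT; OUR BOOKKEEPING ([folklore]; (Q1) FOR THE FORCING).  **THE FORCING WORD OF A `Ψ̂`-CONJUGATED KERNEL IS THE bm FORCING FUNCTIONAL ON TRANSPORTED TABLES**: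
for spread `K`, local `S`, a multiplier vertex family `M`, a `LocStencil₂` pair table `S₂`, a `LocStencilFM` mixed table `M₂` (all at positive rates), `0 < n`, `r ∈ box (d+1) n`, `Ψ̂ = psiKS r n`:
`mmRead n (K3OfK (Ψ̂KΨ̂ᵀ) n S M (W2SymOfK (Ψ̂KΨ̂ᵀ) n S M S₂ M₂) μ y ν y′) = mmRead n (K3OfK K n (𝒯S) (𝒯′M) (W2SymOfK K n (𝒯S) (𝒯′M) (𝒯₄S₂) (𝒯₂M₂)) μ y ν y′)`
(M.45 §3 `e4OfKW_conj_psiKS` with the carrier `W2SymOfK (Ψ̂KΨ̂ᵀ) …` — localised by an1's `vertexFamily₂_W2SymOfK'` — then §1 inside the carrier slot). -/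
theorem mmRead_K3OfK_W2SymOfK_conj_psiKS {K : MKer (d + 1) (Fib d)} (hK : Spr K)
    {S : Fin (d + 1) → Site (d + 1) → MKer (d + 1) (Fib d)} {Cs δs : ℝ} (hS : LocStencil S Cs δs) (hδs : 0 < δs)
    {M : Fin (d + 1) → Site (d + 1) → MKer (d + 1) (Fib d)} {CM δM : ℝ} (hM : VertexFamily M n CM δM) (hδM : 0 < δM)
    {S₂ : Fin (d + 1) → Site (d + 1) → Fin (d + 1) → Site (d + 1) → MKer (d + 1) (Fib d)} {C₂ δ₂ : ℝ} (hS₂ : LocStencil₂ S₂ C₂ δ₂) (hδ₂ : 0 < δ₂)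
    {M₂ : Fin (d + 1) → Site (d + 1) → Fin (d + 1) → Site (d + 1) → MKer (d + 1) (Fib d)} {CF δF : ℝ} (hM₂ : LocStencilFM n M₂ CF δF) (hδF : 0 < δF)
    (μ : Fin (d + 1)) (y : Site (d + 1)) (ν : Fin (d + 1)) (y' : Site (d + 1)) :
    mmRead n (K3OfK (comp (comp (psiKS r n) K) (trK (psiKS r n))) n S M
        (W2SymOfK (comp (comp (psiKS r n) K) (trK (psiKS r n))) n S M S₂ M₂) μ y ν y')
      = mmRead n (K3OfK K n (fun κ u => comp (comp (trK (psiKS r n)) (slotPsiS r n S κ u)) (psiKS r n))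
          (fun ρ w => comp (comp (trK (psiKS r n)) (M ρ w)) (psiKS r n))
          (W2SymOfK K n (fun κ u => comp (comp (trK (psiKS r n)) (slotPsiS r n S κ u)) (psiKS r n))
            (fun ρ w => comp (comp (trK (psiKS r n)) (M ρ w)) (psiKS r n))
            (fun α x β x' => comp (comp (trK (psiKS r n)) (slotPsiS r n (slotPsiS r n S₂ α x) β x')) (psiKS r n))
            (fun κ u ρ w => comp (comp (trK (psiKS r n)) (slotPsiS r n M₂ κ u ρ w)) (psiKS r n))) μ y ν y') := by
  haveI : NeZero n := ⟨hn.ne'⟩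
  have hΨ : Spr (psiKS r n) := spr_psiKS hn hr
  have hK' : Spr (comp (comp (psiKS r n) K) (trK (psiKS r n))) := spr_comp (spr_comp hΨ hK) hΨ.trK
  obtain ⟨C', δ', hδ', hK'd⟩ := id hK'
  have hK'2 : ∃ δ C : ℝ, 0 < δ ∧ 0 ≤ C ∧ Decays (comp (comp (psiKS r n) K) (trK (psiKS r n))) C δ := ⟨δ', |C'|, hδ', abs_nonneg C', decays_of_le hK'd le_rfl⟩
  -- the carrier of the conjugated kernel is localised, slice by slice
  obtain ⟨Cw, δw, hδw, hW2⟩ := vertexFamily₂_W2SymOfK' (N := n) hK'2 hS hδs hM hδM hS₂ hδ₂ hM₂ hδF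
  have hW : ∀ (b : Fin (d + 1)) (w : Site (d + 1)) (b' : Fin (d + 1)) (w' : Site (d + 1)),
      Loc (W2SymOfK (comp (comp (psiKS r n) K) (trK (psiKS r n))) n S M S₂ M₂ b w b' w') := fun b w b' w' => loc_of_vertexFamily₂ hW2 hδw b w b' w'
  -- M.45 §3 with this carrier, then §1 inside the carrier slot (under the binder; the transported carrier closes by η)
  have h := e4OfKW_conj_psiKS (d := d) hn hr hK hS hδs hM hδM hW μ y ν y'
  simp only [conj_W2SymOfK_conj_psiKS hn hr hK hS hδs hM hδM hS₂ hδ₂ hM₂ hδF] at h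
  exact h

end Forcing

/-! ## §3 The (III′) instance: the comb-chart forcing with units, every level, any sym record -/

section Comb

variable {Lc : ℕ} [NeZero Lc]

/-- [folklore] `Ψ̂ᵀ ∘ 0 ∘ Ψ̂ = 0` (termwise). -/
theorem conj_zero (P : MKer (d + 1) (Fib d)) : comp (comp (trK P) (0 : MKer (d + 1) (Fib d))) P = 0 := by
  rw [StepDriftWitness.comp_zero_right]
  funext x z a b
  simp only [comp, Pi.zero_apply, zero_mul, Finset.sum_const_zero, tsum_zero]

/-- [folklore] **THE FOUR-SLOT TRANSPORT OF THE ZERO PAIR TABLE IS ZERO** (`slotPsiS_zero` twice, `conj_zero`) — the forcing is the carrier with the `T`-slot set to `0`. -/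
theorem fourSlot_zero (r : Fin (d + 1) → ℕ) (n : ℕ) :
    (fun (α : Fin (d + 1)) (x : Site (d + 1)) (β : Fin (d + 1)) (x' : Site (d + 1)) =>
        comp (comp (trK (psiKS r n)) (slotPsiS r n (slotPsiS r n (0 : Fin (d + 1) → Site (d + 1) → Fin (d + 1) → Site (d + 1) → MKer (d + 1) (Fib d)) α x) β x')) (psiKS r n))
      = 0 := by
  funext α x β x'
  have h1 : slotPsiS r n (0 : Fin (d + 1) → Site (d + 1) → Fin (d + 1) → Site (d + 1) → MKer (d + 1) (Fib d)) = 0 := slotPsiS_zero r n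
  have h2 : slotPsiS r n (0 : Fin (d + 1) → Site (d + 1) → MKer (d + 1) (Fib d)) = 0 := slotPsiS_zero r n
  simp only [h1, h2, Pi.zero_apply, conj_zero]

/-- [folklore] The zero pair table is a `LocStencil₂` family (constant `0`, any rate). -/
theorem locStencil₂_zero (δ : ℝ) : LocStencil₂ (0 : Fin (d + 1) → Site (d + 1) → Fin (d + 1) → Site (d + 1) → MKer (d + 1) (Fib d)) 0 δ := by
  intro κ u κ' u' p q a b
  simp only [Pi.zero_apply, abs_zero, zero_mul, le_refl]

/-- NOT IN PRINT; OUR BOOKKEEPING ([folklore]; THE (III′) FORCING READ ON THE bm CHART).  **THE COMB-CHART FORCING IS THE bm-CHART FORCING FUNCTIONAL ON TRANSPORTED TABLES**: ANY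
`tabs : SymTables d Lc`, ANY units `s_f s_m`, ANY pins `cE cVH cΛ`, every level `i`, every bond pair (`Ψ̂_S = psiKS (ctrOff (d+1) Lc) Lc`, `ρ_c = ctr (d+1) Lc`; notation of the header):
`mmRead Lc (K3OfK X̃′_i Lc S̃′_i M̃′_i (W2SymOfK X̃′_i Lc S̃′_i M̃′_i 0 M̃₂′_i) μ y ν y′) = mmRead Lc (K3OfK X̃_i Lc (𝒯S̃′_i) (𝒯′M̃′_i) (W2SymOfK X̃_i Lc (𝒯S̃′_i) (𝒯′M̃′_i) 0 (𝒯₂M̃₂′_i)) μ y ν y′)`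
(an2's `GcombSh_eq_conj_psiKS_KInvStep` ⨾ leaf-03's `unitK_conj_psiKS` ⨾ §2, sockets by leaf-02 g78's §1 root letters, `𝒯₄ 0 = 0`).  Compare (E): the SAME functional at
`X̃♮_j = unitK s_f s_m (coDressKBmAt ρ Lc (KInvStep Lc j))` on `(S♮_j, M, M₂)` — leaf-04's 21 ∕ 33_j. -/
theorem combForcing_eq_bm_transport (tabs : SymTables d Lc) (sf sm cE cVH cΛ : ℝ) (i : ℕ)
    (μ : Fin (d + 1)) (y : Site (d + 1)) (ν : Fin (d + 1)) (y' : Site (d + 1)) :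
    mmRead Lc (K3OfK (unitK sf sm (GcombSh (d := d) Lc i)) Lc (unitS sf sm (SpureCombOf tabs cE cVH cΛ i)) (unitM sf sm (tabs.M i))
        (W2SymOfK (unitK sf sm (GcombSh (d := d) Lc i)) Lc (unitS sf sm (SpureCombOf tabs cE cVH cΛ i)) (unitM sf sm (tabs.M i)) 0
          (unitM₂ sf sm (M2Of d Lc tabs.mixFF i))) μ y ν y')
      = mmRead Lc (K3OfK (unitK sf sm (coDressKBmAt (ctr (d + 1) Lc) Lc (KInvStep (d := d) Lc i))) Lc
          (fun κ u => comp (comp (trK (psiKS (ctrOff (d + 1) Lc) Lc)) (slotPsiS (ctrOff (d + 1) Lc) Lc (unitS sf sm (SpureCombOf tabs cE cVH cΛ i)) κ u)) (psiKS (ctrOff (d + 1) Lc) Lc))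
          (fun ρ w => comp (comp (trK (psiKS (ctrOff (d + 1) Lc) Lc)) (unitM sf sm (tabs.M i) ρ w)) (psiKS (ctrOff (d + 1) Lc) Lc))
          (W2SymOfK (unitK sf sm (coDressKBmAt (ctr (d + 1) Lc) Lc (KInvStep (d := d) Lc i))) Lc
            (fun κ u => comp (comp (trK (psiKS (ctrOff (d + 1) Lc) Lc)) (slotPsiS (ctrOff (d + 1) Lc) Lc (unitS sf sm (SpureCombOf tabs cE cVH cΛ i)) κ u)) (psiKS (ctrOff (d + 1) Lc) Lc))
            (fun ρ w => comp (comp (trK (psiKS (ctrOff (d + 1) Lc) Lc)) (unitM sf sm (tabs.M i) ρ w)) (psiKS (ctrOff (d + 1) Lc) Lc))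
            0
            (fun κ u ρ w => comp (comp (trK (psiKS (ctrOff (d + 1) Lc) Lc)) (slotPsiS (ctrOff (d + 1) Lc) Lc (unitM₂ sf sm (M2Of d Lc tabs.mixFF i)) κ u ρ w))
              (psiKS (ctrOff (d + 1) Lc) Lc))) μ y ν y') := by
  have hLc : 0 < Lc := Nat.pos_of_ne_zero (NeZero.ne Lc)
  have hr : ctrOff (d + 1) Lc ∈ box (d + 1) Lc := ctrOff_mem_box hLc
  obtain ⟨δ, C, hδ, -, hG⟩ := decays_coDressKBmAt_KInvStep (d := d) (Lc := Lc) hr i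
  have hK : Spr (unitK sf sm (coDressKBmAt (ctr (d + 1) Lc) Lc (KInvStep (d := d) Lc i))) := ⟨_, δ, hδ, decays_unitK (sf := sf) (sm := sm) hG⟩
  obtain ⟨Cs, δs, hδs, hS⟩ := exists_locStencil_unitS_SpureCombOf tabs sf sm cE cVH cΛ i
  obtain ⟨CM, δM, hδM, hM⟩ := exists_vertexFamily_unitM_tabs tabs sf sm i
  obtain ⟨C₂, δ₂, hδ₂, hM₂⟩ := exists_locStencilFM_unitM₂_M2Of_tabs tabs sf sm i
  rw [GcombSh_eq_conj_psiKS_KInvStep Lc i, unitK_conj_psiKS,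
    mmRead_K3OfK_W2SymOfK_conj_psiKS hLc hr hK hS hδs hM hδM (locStencil₂_zero (d := d) 1) one_pos hM₂ hδ₂ μ y ν y', fourSlot_zero]

/-- [folklore] **THE SAME AS BI-STENCIL TABLES** (any scalars `c cB`, any border `B`): the table `κ u κ′ u′ ↦ c • [comb forcing] κ u κ′ u′ + cB • B κ u κ′ u′` of `hB0` IS the table
`κ u κ′ u′ ↦ c • [bm functional on transported tables] κ u κ′ u′ + cB • B κ u κ′ u′`. -/
theorem combForcingTable_eq_bm_transport (tabs : SymTables d Lc) (sf sm cE cVH cΛ c cB : ℝ) (B : Tab d) (i : ℕ) :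
    (fun κ u κ' u' => c • mmRead Lc (K3OfK (unitK sf sm (GcombSh (d := d) Lc i)) Lc (unitS sf sm (SpureCombOf tabs cE cVH cΛ i)) (unitM sf sm (tabs.M i))
        (W2SymOfK (unitK sf sm (GcombSh (d := d) Lc i)) Lc (unitS sf sm (SpureCombOf tabs cE cVH cΛ i)) (unitM sf sm (tabs.M i)) 0
          (unitM₂ sf sm (M2Of d Lc tabs.mixFF i))) κ u κ' u') + cB • B κ u κ' u')
      = fun κ u κ' u' => c • mmRead Lc (K3OfK (unitK sf sm (coDressKBmAt (ctr (d + 1) Lc) Lc (KInvStep (d := d) Lc i))) Lc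
          (fun κ u => comp (comp (trK (psiKS (ctrOff (d + 1) Lc) Lc)) (slotPsiS (ctrOff (d + 1) Lc) Lc (unitS sf sm (SpureCombOf tabs cE cVH cΛ i)) κ u)) (psiKS (ctrOff (d + 1) Lc) Lc))
          (fun ρ w => comp (comp (trK (psiKS (ctrOff (d + 1) Lc) Lc)) (unitM sf sm (tabs.M i) ρ w)) (psiKS (ctrOff (d + 1) Lc) Lc))
          (W2SymOfK (unitK sf sm (coDressKBmAt (ctr (d + 1) Lc) Lc (KInvStep (d := d) Lc i))) Lc
            (fun κ u => comp (comp (trK (psiKS (ctrOff (d + 1) Lc) Lc)) (slotPsiS (ctrOff (d + 1) Lc) Lc (unitS sf sm (SpureCombOf tabs cE cVH cΛ i)) κ u)) (psiKS (ctrOff (d + 1) Lc) Lc))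
            (fun ρ w => comp (comp (trK (psiKS (ctrOff (d + 1) Lc) Lc)) (unitM sf sm (tabs.M i) ρ w)) (psiKS (ctrOff (d + 1) Lc) Lc))
            0
            (fun κ u ρ w => comp (comp (trK (psiKS (ctrOff (d + 1) Lc) Lc)) (slotPsiS (ctrOff (d + 1) Lc) Lc (unitM₂ sf sm (M2Of d Lc tabs.mixFF i)) κ u ρ w))
              (psiKS (ctrOff (d + 1) Lc) Lc))) κ u κ' u') + cB • B κ u κ' u' := by
  funext κ u κ' u'
  rw [combForcing_eq_bm_transport]

/-! ## §4 Under the zero mode: `hB0`'s summand, and the `d = 3` literal at an1's record -/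

/-- NOT IN PRINT; OUR BOOKKEEPING ([folklore]; `hB0`'s SUMMAND READ ON THE bm CHART).  **THE CELL CHARGE OF THE COMB FORCING IS THE CELL CHARGE OF THE bm FUNCTIONAL ON TRANSPORTED
TABLES** — every period `N`, every direction pair, every leg pair, any `c cB B` (the table equality under `zmode`). -/
theorem zmode_combForcing_eq_bm_transport (tabs : SymTables d Lc) (sf sm cE cVH cΛ c cB : ℝ) (B : Tab d) (i N : ℕ) (κ κ' : Fin (d + 1)) (a b : Fib d) :
    zmode N (fun κ u κ' u' => c • mmRead Lc (K3OfK (unitK sf sm (GcombSh (d := d) Lc i)) Lc (unitS sf sm (SpureCombOf tabs cE cVH cΛ i)) (unitM sf sm (tabs.M i))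
        (W2SymOfK (unitK sf sm (GcombSh (d := d) Lc i)) Lc (unitS sf sm (SpureCombOf tabs cE cVH cΛ i)) (unitM sf sm (tabs.M i)) 0
          (unitM₂ sf sm (M2Of d Lc tabs.mixFF i))) κ u κ' u') + cB • B κ u κ' u') κ κ' a b
      = zmode N (fun κ u κ' u' => c • mmRead Lc (K3OfK (unitK sf sm (coDressKBmAt (ctr (d + 1) Lc) Lc (KInvStep (d := d) Lc i))) Lc
          (fun κ u => comp (comp (trK (psiKS (ctrOff (d + 1) Lc) Lc)) (slotPsiS (ctrOff (d + 1) Lc) Lc (unitS sf sm (SpureCombOf tabs cE cVH cΛ i)) κ u)) (psiKS (ctrOff (d + 1) Lc) Lc))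
          (fun ρ w => comp (comp (trK (psiKS (ctrOff (d + 1) Lc) Lc)) (unitM sf sm (tabs.M i) ρ w)) (psiKS (ctrOff (d + 1) Lc) Lc))
          (W2SymOfK (unitK sf sm (coDressKBmAt (ctr (d + 1) Lc) Lc (KInvStep (d := d) Lc i))) Lc
            (fun κ u => comp (comp (trK (psiKS (ctrOff (d + 1) Lc) Lc)) (slotPsiS (ctrOff (d + 1) Lc) Lc (unitS sf sm (SpureCombOf tabs cE cVH cΛ i)) κ u)) (psiKS (ctrOff (d + 1) Lc) Lc))
            (fun ρ w => comp (comp (trK (psiKS (ctrOff (d + 1) Lc) Lc)) (unitM sf sm (tabs.M i) ρ w)) (psiKS (ctrOff (d + 1) Lc) Lc))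
            0
            (fun κ u ρ w => comp (comp (trK (psiKS (ctrOff (d + 1) Lc) Lc)) (slotPsiS (ctrOff (d + 1) Lc) Lc (unitM₂ sf sm (M2Of d Lc tabs.mixFF i)) κ u ρ w))
              (psiKS (ctrOff (d + 1) Lc) Lc))) κ u κ' u') + cB • B κ u κ' u') κ κ' a b := by
  rw [combForcingTable_eq_bm_transport]

end Comb
/-! ### `d = 3`: the OWNER's (J) tokens (`sfStep ∕ smStep 3`, `symTablesAn1S2 3 Lc cΛt`, `c = cE₂·Lc^{2(3+1)}`, `B = tabs.vh₂S`) -/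

section Literal

variable {Lc : ℕ} [NeZero Lc]

/-- NOT IN PRINT; OUR BOOKKEEPING ([folklore]; `hB0`'s SUMMAND AT an1's RECORD, TOKEN FOR TOKEN).  For every level `i`, period `N`, directions `κ κ′`, legs `a b`:
`zmode N (b̃′_i) κ κ′ a b = zmode N (c • mmRead Lc (K3OfK X̃_i Lc (𝒯S̃′_i) (𝒯′M̃′_i) (W2SymOfK X̃_i Lc (𝒯S̃′_i) (𝒯′M̃′_i) 0 (𝒯₂M̃₂′_i))) + cB • tabs.vh₂S) κ κ′ a b` with the wall's units
`sfStep Lc i ∕ smStep 3 Lc i`, `tabs = symTablesAn1S2 3 Lc cΛt`, `c = cE₂·Lc^{2(3+1)}` — the four `zmode Lc (…)` summands of the OWNER's `hB0` (both bond orders, `N = Lc`) are instances. -/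
theorem zmode_combForcing_eq_bm_transport_lit (cΛt cE cVH cΛ cE₂ cB : ℝ) (i N : ℕ) (κ κ' : Fin (3 + 1)) (a b : Fib 3) :
    zmode N (fun κ u κ' u' => (cE₂ * (Lc : ℝ) ^ (2 * (3 + 1))) • mmRead Lc (K3OfK (unitK (sfStep Lc i) (smStep 3 Lc i) (GcombSh (d := 3) Lc i)) Lc
        (unitS (sfStep Lc i) (smStep 3 Lc i) (SpureCombOf (symTablesAn1S2 3 Lc cΛt) cE cVH cΛ i)) (unitM (sfStep Lc i) (smStep 3 Lc i) ((symTablesAn1S2 3 Lc cΛt).M i))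
        (W2SymOfK (unitK (sfStep Lc i) (smStep 3 Lc i) (GcombSh (d := 3) Lc i)) Lc (unitS (sfStep Lc i) (smStep 3 Lc i) (SpureCombOf (symTablesAn1S2 3 Lc cΛt) cE cVH cΛ i))
          (unitM (sfStep Lc i) (smStep 3 Lc i) ((symTablesAn1S2 3 Lc cΛt).M i)) 0 (unitM₂ (sfStep Lc i) (smStep 3 Lc i) (M2Of 3 Lc (symTablesAn1S2 3 Lc cΛt).mixFF i))) κ u κ' u')
        + cB • (symTablesAn1S2 3 Lc cΛt).vh₂S κ u κ' u') κ κ' a b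
      = zmode N (fun κ u κ' u' => (cE₂ * (Lc : ℝ) ^ (2 * (3 + 1))) • mmRead Lc (K3OfK (unitK (sfStep Lc i) (smStep 3 Lc i) (coDressKBmAt (ctr (3 + 1) Lc) Lc (KInvStep (d := 3) Lc i))) Lc
          (fun κ u => comp (comp (trK (psiKS (ctrOff (3 + 1) Lc) Lc))
            (slotPsiS (ctrOff (3 + 1) Lc) Lc (unitS (sfStep Lc i) (smStep 3 Lc i) (SpureCombOf (symTablesAn1S2 3 Lc cΛt) cE cVH cΛ i)) κ u)) (psiKS (ctrOff (3 + 1) Lc) Lc))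
          (fun ρ w => comp (comp (trK (psiKS (ctrOff (3 + 1) Lc) Lc)) (unitM (sfStep Lc i) (smStep 3 Lc i) ((symTablesAn1S2 3 Lc cΛt).M i) ρ w)) (psiKS (ctrOff (3 + 1) Lc) Lc))
          (W2SymOfK (unitK (sfStep Lc i) (smStep 3 Lc i) (coDressKBmAt (ctr (3 + 1) Lc) Lc (KInvStep (d := 3) Lc i))) Lc
            (fun κ u => comp (comp (trK (psiKS (ctrOff (3 + 1) Lc) Lc))
              (slotPsiS (ctrOff (3 + 1) Lc) Lc (unitS (sfStep Lc i) (smStep 3 Lc i) (SpureCombOf (symTablesAn1S2 3 Lc cΛt) cE cVH cΛ i)) κ u)) (psiKS (ctrOff (3 + 1) Lc) Lc))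
            (fun ρ w => comp (comp (trK (psiKS (ctrOff (3 + 1) Lc) Lc)) (unitM (sfStep Lc i) (smStep 3 Lc i) ((symTablesAn1S2 3 Lc cΛt).M i) ρ w)) (psiKS (ctrOff (3 + 1) Lc) Lc))
            0
            (fun κ u ρ w => comp (comp (trK (psiKS (ctrOff (3 + 1) Lc) Lc))
              (slotPsiS (ctrOff (3 + 1) Lc) Lc (unitM₂ (sfStep Lc i) (smStep 3 Lc i) (M2Of 3 Lc (symTablesAn1S2 3 Lc cΛt).mixFF i)) κ u ρ w)) (psiKS (ctrOff (3 + 1) Lc) Lc))) κ u κ' u')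
        + cB • (symTablesAn1S2 3 Lc cΛt).vh₂S κ u κ' u') κ κ' a b :=
  zmode_combForcing_eq_bm_transport (symTablesAn1S2 3 Lc cΛt) (sfStep Lc i) (smStep 3 Lc i) cE cVH cΛ (cE₂ * (Lc : ℝ) ^ (2 * (3 + 1))) cB
    (symTablesAn1S2 3 Lc cΛt).vh₂S i N κ κ' a b

end Literal

end Summit.QuantumFields.BalabanUV.Beta.GAN24.CombForcingTransport

end
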